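import Summits.Ventures.YMGap.RobustBall.RobustAreaLawBallW
import Summits.Ventures.YMGap.RobustBall.TorusRowsSU2
import Summits.Ventures.YMGap.RobustBall.RowsSU2
import HarnessLib

/-!
# Robust ball (Y2), area-law side — certified SU(2), d = 4 TIER-2 AREA-LAW ROWS (vertical window, no range cut-off)

HONEST FRAMING: venture file of the cell `pub-ymgap` (QuantumFields programme), track ROBUST-BALL (ds-4).  ROWS of the tier-2 ball area law
(`areaLawOnBallW_of_oneLinkKRModulus`, slice dimension `n = 3`) for `SU(2)`, `d = 4` with the tree's unit-ball quarter modulus `K = 1` (slab radius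
`3β_W/2 ≤ 1`, `SlabAreaLawDimensions.su2_oneLinkKRModulus_of_le_one`): the WEIGHTED row condition is
`e^{κ/3}·e^{ε₀}(1 + 2√2 ε₁)·(3β_W/2) + √2 ε₁ < 1` (`su2_areaLawOnBallW_of_row`), certified by exact rational arithmetic (`exp_le_taylor4`,
`√2 ≤ 1.41422`, `(6/5)^{1/3} ≤ 1.0627`, `(3/2)^{1/3} ≤ 1.1448`) on the one-parameter balls `(ε₀, ε₁) = (2ε, ε)`:
`(β⋆_W, κ, ε) = (1/3, log(6/5), 1/10)` — the SAME radius as rb-p2's tier-1 row at `β_W = 1/3` —, `(1/2, log(6/5), 7/200)`,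
`(1/8, log(6/5), 27/100)`, `(1/5, log(6/5), 19/100)`, `(1/3, log(3/2), 9/100)`; and in `d = 3` (slice dimension `n = 2`, slab factor `β_W ≤ 1`,
weight factor `(6/5)^{1/2} ≤ 1.0955`): `(1/4, log(6/5), 21/100)`, `(1/2, log(6/5), 9/100)`, `(3/4, log(6/5), 3/100)`.  Reading: Wilson's AREA LAW holds uniformly for every member of
the diameter-weighted ball `ClusterDomain κ (2ε) ε` (every polymer activity allowed, loads weighted `e^{κ diam X}`, NO range cut-off) that is
slab-local with vertical dependence diameter `mv`, for every `mv ≥ 1`; constants uniform on the ball, rate `κ/(6 mv)`.  Lossy vertex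
`ℓ = Λ₀ = ε₁`.  Strong-coupling finite-lattice statement; nothing about the continuum, a mass gap, or Clay.
-/

noncomputable section

open MeasureTheory ProbabilityTheory Real
open Literature.MathematicalPhysics.QuantumLattice (fundamentalRep continuous_fundamentalRep fundamentalRep_apply)
open Literature.MathematicalPhysics.QuantumFieldTheory
open Literature.MathematicalPhysics.QuantumFieldTheory.DurhuusFrohlich
open Literature.MathematicalPhysics.QuantumFieldTheory.Balaban1983to89.StrongCouplingDobrushinWindow (OneLinkKRModulus)

namespace Summit.Ventures.YMGap.RobustBall

/-! ### The schematic row -/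

/-- **SU(2), d = 4 TIER-2 area-law rows, schematic form** (slice dimension `n = 3`): with the slab modulus `K = 1` on radius `≤ 1`
(`SlabAreaLawDimensions.su2_oneLinkKRModulus_of_le_one`, slab radius `2n·β_tH = 3β_W/2 ≤ 1`; tree coupling `β = β_W/2`, 't Hooft `β_W/4`) and a
weight `κ > 0`, the weighted row condition reads `e^{κ/3}·e^{ε₀}(1 + 2√2 ε₁)·(3β_W/2) + √2 ε₁ < 1`. [folklore] -/
theorem su2_areaLawOnBallW_of_row {βW κ ε₀ ε₁ : ℝ} (hβ : 0 ≤ βW) (hβ1 : 3 * βW / 2 ≤ 1) (hκ : 0 < κ) (h₁ : 0 ≤ ε₁)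
    {mv : ℕ} (hmv : 1 ≤ mv)
    (hrow : Real.exp (κ / 3) * (Real.exp ε₀ * (1 + 2 * Real.sqrt 2 * ε₁) * (3 * βW / 2)) + Real.sqrt 2 * ε₁ < 1) :
    AreaLawOnBallW 2 (3 + 1) (βW / 2) κ ε₀ ε₁ mv := by
  have hmod := SlabAreaLawDimensions.su2_oneLinkKRModulus_of_le_one (R := 3 * βW / 2) hβ1
  have habs : |βW / 2 / (2 : ℕ)| = βW / 4 := by
    rw [abs_of_nonneg (by positivity)]; push_cast; ring
  refine areaLawOnBallW_of_oneLinkKRModulus (n := 3) le_rfl (by norm_num) (βW / 2) zero_le_one hmod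
    (by rw [habs]; push_cast; linarith) hκ h₁ hmv ?_
  rw [habs]
  calc Real.exp (κ / ((3 : ℕ) : ℝ)) * (Real.exp ε₀ * (1 + 2 * Real.sqrt (2 : ℕ) * ε₁) * (2 * ((3 : ℕ) : ℝ) * (βW / 4) * 1)) +
        Real.sqrt (2 : ℕ) * ε₁
      = Real.exp (κ / 3) * (Real.exp ε₀ * (1 + 2 * Real.sqrt 2 * ε₁) * (3 * βW / 2)) + Real.sqrt 2 * ε₁ := by push_cast; ring
    _ < 1 := hrow

/-! ### Exact numeric majorants -/

/-- `(6/5)^{1/3} = e^{log(6/5)/3} ≤ 1.0627` (cube both sides: `1.0627³ ≥ 6/5`). [folklore] -/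
theorem exp_log_six_fifths_div_three_le : Real.exp (Real.log (6 / 5) / 3) ≤ 10627 / 10000 := by
  have h3 : Real.exp (Real.log (6 / 5) / 3) ^ 3 = 6 / 5 := by
    rw [← Real.exp_nat_mul]
    rw [show ((3 : ℕ) : ℝ) * (Real.log (6 / 5) / 3) = Real.log (6 / 5) by push_cast; ring, Real.exp_log (by norm_num)]
  have hle : Real.exp (Real.log (6 / 5) / 3) ^ 3 ≤ (10627 / 10000 : ℝ) ^ 3 := by rw [h3]; norm_num
  exact le_of_pow_le_pow_left₀ (by norm_num) (by norm_num) hle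

/-- `(3/2)^{1/3} = e^{log(3/2)/3} ≤ 1.1448` (cube both sides: `1.1448³ ≥ 3/2`). [folklore] -/
theorem exp_log_three_halves_div_three_le : Real.exp (Real.log (3 / 2) / 3) ≤ 11448 / 10000 := by
  have h3 : Real.exp (Real.log (3 / 2) / 3) ^ 3 = 3 / 2 := by
    rw [← Real.exp_nat_mul]
    rw [show ((3 : ℕ) : ℝ) * (Real.log (3 / 2) / 3) = Real.log (3 / 2) by push_cast; ring, Real.exp_log (by norm_num)]
  have hle : Real.exp (Real.log (3 / 2) / 3) ^ 3 ≤ (11448 / 10000 : ℝ) ^ 3 := by rw [h3]; norm_num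
  exact le_of_pow_le_pow_left₀ (by norm_num) (by norm_num) hle

/-- The certified row inequality from majorants: if `e^{κ/3} ≤ E₃`, `e^{ε₀} ≤ E₀`, `√2 ≤ S` and
`E₃·E₀·(1 + 2Sε₁)·(3β_W/2) + Sε₁ < 1` (all data nonnegative), the weighted row condition holds. [folklore] -/
theorem su2_rowW_lt_one_of_bounds {βW κ ε₀ ε₁ E₃ E₀ S : ℝ} (hβ : 0 ≤ βW) (h₁ : 0 ≤ ε₁)
    (hE₃ : Real.exp (κ / 3) ≤ E₃) (hE₀ : Real.exp ε₀ ≤ E₀) (hS : Real.sqrt 2 ≤ S)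
    (h : E₃ * (E₀ * (1 + 2 * S * ε₁) * (3 * βW / 2)) + S * ε₁ < 1) :
    Real.exp (κ / 3) * (Real.exp ε₀ * (1 + 2 * Real.sqrt 2 * ε₁) * (3 * βW / 2)) + Real.sqrt 2 * ε₁ < 1 := by
  have hs0 : 0 ≤ Real.sqrt 2 := Real.sqrt_nonneg _
  have he3 : 0 < Real.exp (κ / 3) := Real.exp_pos _
  have he0 : 0 < Real.exp ε₀ := Real.exp_pos _
  have h1 : 1 + 2 * Real.sqrt 2 * ε₁ ≤ 1 + 2 * S * ε₁ := by nlinarith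
  have h2 : Real.exp ε₀ * (1 + 2 * Real.sqrt 2 * ε₁) * (3 * βW / 2) ≤ E₀ * (1 + 2 * S * ε₁) * (3 * βW / 2) :=
    mul_le_mul_of_nonneg_right (mul_le_mul hE₀ h1 (by positivity) (he0.le.trans hE₀)) (by positivity)
  have h3 : Real.exp (κ / 3) * (Real.exp ε₀ * (1 + 2 * Real.sqrt 2 * ε₁) * (3 * βW / 2)) ≤
      E₃ * (E₀ * (1 + 2 * S * ε₁) * (3 * βW / 2)) :=
    mul_le_mul hE₃ h2 (by positivity) (he3.le.trans hE₃)
  have h4 : Real.sqrt 2 * ε₁ ≤ S * ε₁ := mul_le_mul_of_nonneg_right hS h₁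
  linarith

/-! ### The certified rows -/

/-- **CERTIFIED SU(2), d = 4 TIER-2 AREA-LAW ROW `(β⋆_W, κ, ε) = (1/3, log(6/5), 1/10)`** (tree coupling `β = 1/6`): for the one-parameter
diameter-weighted ball `ClusterDomain (log(6/5)) (1/5) (1/10)` — oscillation load `≤ 2ε`, Lipschitz loads `≤ ε`, each polymer weighted
`(6/5)^{diam X}`, NO range cut-off — and every vertical dependence diameter `mv ≥ 1`: `AreaLawOnBallW 2 4 (1/6) (log(6/5)) (1/5) (1/10) mv`.
The SAME radius `1/10` as the tier-1 row `su2_areaLawOnBall_oneThird`.  Row certificate: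
`1.0627 · T₄(1/5) · (1 + 2·1.41422/10) · (1/2) + 0.141422 < 1` (exact rationals). [folklore] -/
theorem su2_areaLawOnBallW_oneThird_w65 {mv : ℕ} (hmv : 1 ≤ mv) :
    AreaLawOnBallW 2 4 (1 / 6) (Real.log (6 / 5)) (1 / 5) (1 / 10) mv := by
  have h6 : (1 / 6 : ℝ) = 1 / 3 / 2 := by norm_num
  rw [h6]
  show AreaLawOnBallW 2 (3 + 1) _ _ _ _ mv
  refine su2_areaLawOnBallW_of_row (βW := 1 / 3) (by norm_num) (by norm_num) (Real.log_pos (by norm_num)) (by norm_num) hmv ?_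
  refine su2_rowW_lt_one_of_bounds (by norm_num) (by norm_num) exp_log_six_fifths_div_three_le
    (exp_le_taylor4 (x := 1 / 5) (by norm_num) (by norm_num)) sqrt_two_le ?_
  norm_num

/-- **CERTIFIED SU(2), d = 4 TIER-2 AREA-LAW ROW `(β⋆_W, κ, ε) = (1/2, log(6/5), 7/200)`** (tree coupling `1/4`): one-parameter ball
`ClusterDomain (log(6/5)) (7/100) (7/200)`, every `mv ≥ 1`: `AreaLawOnBallW 2 4 (1/4) (log(6/5)) (7/100) (7/200) mv`. [folklore] -/
theorem su2_areaLawOnBallW_oneHalf_w65 {mv : ℕ} (hmv : 1 ≤ mv) :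
    AreaLawOnBallW 2 4 (1 / 4) (Real.log (6 / 5)) (7 / 100) (7 / 200) mv := by
  have h6 : (1 / 4 : ℝ) = 1 / 2 / 2 := by norm_num
  rw [h6]
  show AreaLawOnBallW 2 (3 + 1) _ _ _ _ mv
  refine su2_areaLawOnBallW_of_row (βW := 1 / 2) (by norm_num) (by norm_num) (Real.log_pos (by norm_num)) (by norm_num) hmv ?_
  refine su2_rowW_lt_one_of_bounds (by norm_num) (by norm_num) exp_log_six_fifths_div_three_le
    (exp_le_taylor4 (x := 7 / 100) (by norm_num) (by norm_num)) sqrt_two_le ?_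
  norm_num

/-- **CERTIFIED SU(2), d = 4 TIER-2 AREA-LAW ROW `(β⋆_W, κ, ε) = (1/8, log(6/5), 27/100)`** (tree coupling `1/16`, the strong-coupling
reference point of the mass-gap table): one-parameter ball `ClusterDomain (log(6/5)) (27/50) (27/100)`, every `mv ≥ 1`:
`AreaLawOnBallW 2 4 (1/16) (log(6/5)) (27/50) (27/100) mv`. [folklore] -/
theorem su2_areaLawOnBallW_oneEighth_w65 {mv : ℕ} (hmv : 1 ≤ mv) :
    AreaLawOnBallW 2 4 (1 / 16) (Real.log (6 / 5)) (27 / 50) (27 / 100) mv := by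
  have h6 : (1 / 16 : ℝ) = 1 / 8 / 2 := by norm_num
  rw [h6]
  show AreaLawOnBallW 2 (3 + 1) _ _ _ _ mv
  refine su2_areaLawOnBallW_of_row (βW := 1 / 8) (by norm_num) (by norm_num) (Real.log_pos (by norm_num)) (by norm_num) hmv ?_
  refine su2_rowW_lt_one_of_bounds (by norm_num) (by norm_num) exp_log_six_fifths_div_three_le
    (exp_le_taylor4 (x := 27 / 50) (by norm_num) (by norm_num)) sqrt_two_le ?_
  norm_num

/-- **CERTIFIED SU(2), d = 4 TIER-2 AREA-LAW ROW `(β⋆_W, κ, ε) = (1/5, log(6/5), 19/100)`** (tree coupling `1/10`): one-parameter ball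
`ClusterDomain (log(6/5)) (19/50) (19/100)`, every `mv ≥ 1`: `AreaLawOnBallW 2 4 (1/10) (log(6/5)) (19/50) (19/100) mv`. [folklore] -/
theorem su2_areaLawOnBallW_oneFifth_w65 {mv : ℕ} (hmv : 1 ≤ mv) :
    AreaLawOnBallW 2 4 (1 / 10) (Real.log (6 / 5)) (19 / 50) (19 / 100) mv := by
  have h6 : (1 / 10 : ℝ) = 1 / 5 / 2 := by norm_num
  rw [h6]
  show AreaLawOnBallW 2 (3 + 1) _ _ _ _ mv
  refine su2_areaLawOnBallW_of_row (βW := 1 / 5) (by norm_num) (by norm_num) (Real.log_pos (by norm_num)) (by norm_num) hmv ?_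
  refine su2_rowW_lt_one_of_bounds (by norm_num) (by norm_num) exp_log_six_fifths_div_three_le
    (exp_le_taylor4 (x := 19 / 50) (by norm_num) (by norm_num)) sqrt_two_le ?_
  norm_num

/-- **CERTIFIED SU(2), d = 4 TIER-2 AREA-LAW ROW `(β⋆_W, κ, ε) = (1/3, log(3/2), 9/100)`** (tree coupling `1/6`, the heavier weight
`(3/2)^{diam X}`): one-parameter ball `ClusterDomain (log(3/2)) (9/50) (9/100)`, every `mv ≥ 1`:
`AreaLawOnBallW 2 4 (1/6) (log(3/2)) (9/50) (9/100) mv`. [folklore] -/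
theorem su2_areaLawOnBallW_oneThird_w32 {mv : ℕ} (hmv : 1 ≤ mv) :
    AreaLawOnBallW 2 4 (1 / 6) (Real.log (3 / 2)) (9 / 50) (9 / 100) mv := by
  have h6 : (1 / 6 : ℝ) = 1 / 3 / 2 := by norm_num
  rw [h6]
  show AreaLawOnBallW 2 (3 + 1) _ _ _ _ mv
  refine su2_areaLawOnBallW_of_row (βW := 1 / 3) (by norm_num) (by norm_num) (Real.log_pos (by norm_num)) (by norm_num) hmv ?_
  refine su2_rowW_lt_one_of_bounds (by norm_num) (by norm_num) exp_log_three_halves_div_three_le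
    (exp_le_taylor4 (x := 9 / 50) (by norm_num) (by norm_num)) sqrt_two_le ?_
  norm_num

/-! ### `d = 3` rows (slice dimension `n = 2`): the tier-2 area law on the Y4-side balls -/

/-- **SU(2), d = 3 TIER-2 area-law rows, schematic form** (slice dimension `n = 2`): slab radius `2n·β_tH = β_W ≤ 1` (`K = 1`), weight
`κ > 0`; the weighted row condition reads `e^{κ/2}·e^{ε₀}(1 + 2√2 ε₁)·β_W + √2 ε₁ < 1` (only `2n = 4` plaquette neighbours in the slice).
[folklore] -/
theorem su2_areaLawOnBallW_dim3_of_row {βW κ ε₀ ε₁ : ℝ} (hβ : 0 ≤ βW) (hβ1 : βW ≤ 1) (hκ : 0 < κ) (h₁ : 0 ≤ ε₁)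
    {mv : ℕ} (hmv : 1 ≤ mv)
    (hrow : Real.exp (κ / 2) * (Real.exp ε₀ * (1 + 2 * Real.sqrt 2 * ε₁) * βW) + Real.sqrt 2 * ε₁ < 1) :
    AreaLawOnBallW 2 (2 + 1) (βW / 2) κ ε₀ ε₁ mv := by
  have hmod := SlabAreaLawDimensions.su2_oneLinkKRModulus_of_le_one (R := βW) hβ1
  have habs : |βW / 2 / (2 : ℕ)| = βW / 4 := by
    rw [abs_of_nonneg (by positivity)]; push_cast; ring
  refine areaLawOnBallW_of_oneLinkKRModulus (n := 2) le_rfl (by norm_num) (βW / 2) zero_le_one hmod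
    (by rw [habs]; push_cast; linarith) hκ h₁ hmv ?_
  rw [habs]
  calc Real.exp (κ / ((2 : ℕ) : ℝ)) * (Real.exp ε₀ * (1 + 2 * Real.sqrt (2 : ℕ) * ε₁) * (2 * ((2 : ℕ) : ℝ) * (βW / 4) * 1)) +
        Real.sqrt (2 : ℕ) * ε₁
      = Real.exp (κ / 2) * (Real.exp ε₀ * (1 + 2 * Real.sqrt 2 * ε₁) * βW) + Real.sqrt 2 * ε₁ := by push_cast; ring
    _ < 1 := hrow

/-- `(6/5)^{1/2} = e^{log(6/5)/2} ≤ 1.0955` (square both sides). [folklore] -/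
theorem exp_log_six_fifths_div_two_le : Real.exp (Real.log (6 / 5) / 2) ≤ 10955 / 10000 := by
  have h2 : Real.exp (Real.log (6 / 5) / 2) ^ 2 = 6 / 5 := by
    rw [← Real.exp_nat_mul]
    rw [show ((2 : ℕ) : ℝ) * (Real.log (6 / 5) / 2) = Real.log (6 / 5) by push_cast; ring, Real.exp_log (by norm_num)]
  have hle : Real.exp (Real.log (6 / 5) / 2) ^ 2 ≤ (10955 / 10000 : ℝ) ^ 2 := by rw [h2]; norm_num
  exact le_of_pow_le_pow_left₀ (by norm_num) (by norm_num) hle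

/-- The certified `d = 3` row inequality from majorants (as `su2_rowW_lt_one_of_bounds`, slab factor `β_W`). [folklore] -/
theorem su2_rowW_dim3_lt_one_of_bounds {βW κ ε₀ ε₁ E₂ E₀ S : ℝ} (hβ : 0 ≤ βW) (h₁ : 0 ≤ ε₁)
    (hE₂ : Real.exp (κ / 2) ≤ E₂) (hE₀ : Real.exp ε₀ ≤ E₀) (hS : Real.sqrt 2 ≤ S)
    (h : E₂ * (E₀ * (1 + 2 * S * ε₁) * βW) + S * ε₁ < 1) :
    Real.exp (κ / 2) * (Real.exp ε₀ * (1 + 2 * Real.sqrt 2 * ε₁) * βW) + Real.sqrt 2 * ε₁ < 1 := by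
  have hs0 : 0 ≤ Real.sqrt 2 := Real.sqrt_nonneg _
  have he2 : 0 < Real.exp (κ / 2) := Real.exp_pos _
  have he0 : 0 < Real.exp ε₀ := Real.exp_pos _
  have h1 : 1 + 2 * Real.sqrt 2 * ε₁ ≤ 1 + 2 * S * ε₁ := by nlinarith
  have h2 : Real.exp ε₀ * (1 + 2 * Real.sqrt 2 * ε₁) * βW ≤ E₀ * (1 + 2 * S * ε₁) * βW :=
    mul_le_mul_of_nonneg_right (mul_le_mul hE₀ h1 (by positivity) (he0.le.trans hE₀)) hβ
  have h3 : Real.exp (κ / 2) * (Real.exp ε₀ * (1 + 2 * Real.sqrt 2 * ε₁) * βW) ≤ E₂ * (E₀ * (1 + 2 * S * ε₁) * βW) :=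
    mul_le_mul hE₂ h2 (by positivity) (he2.le.trans hE₂)
  have h4 : Real.sqrt 2 * ε₁ ≤ S * ε₁ := mul_le_mul_of_nonneg_right hS h₁
  linarith

/-- **CERTIFIED SU(2), d = 3 TIER-2 AREA-LAW ROW `(β⋆_W, κ, ε) = (1/4, log(6/5), 21/100)`** (tree coupling `1/8`; the Wilson coupling of
Y4's certified `d = 3` ball): `AreaLawOnBallW 2 3 (1/8) (log(6/5)) (21/50) (21/100) mv` for every `mv ≥ 1`.  Certificate
`1.0955·T₄(21/50)(1 + 2·1.41422·0.21)(1/4) + 1.41422·0.21 < 1`. [folklore] -/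
theorem su2_areaLawOnBallW_dim3_oneQuarter_w65 {mv : ℕ} (hmv : 1 ≤ mv) :
    AreaLawOnBallW 2 3 (1 / 8) (Real.log (6 / 5)) (21 / 50) (21 / 100) mv := by
  have h6 : (1 / 8 : ℝ) = 1 / 4 / 2 := by norm_num
  rw [h6]
  show AreaLawOnBallW 2 (2 + 1) _ _ _ _ mv
  refine su2_areaLawOnBallW_dim3_of_row (βW := 1 / 4) (by norm_num) (by norm_num) (Real.log_pos (by norm_num)) (by norm_num)
    hmv ?_
  refine su2_rowW_dim3_lt_one_of_bounds (by norm_num) (by norm_num) exp_log_six_fifths_div_two_le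
    (exp_le_taylor4 (x := 21 / 50) (by norm_num) (by norm_num)) sqrt_two_le ?_
  norm_num

/-- **CERTIFIED SU(2), d = 3 TIER-2 AREA-LAW ROW `(β⋆_W, κ, ε) = (1/2, log(6/5), 9/100)`** (tree coupling `1/4`):
`AreaLawOnBallW 2 3 (1/4) (log(6/5)) (9/50) (9/100) mv` for every `mv ≥ 1`. [folklore] -/
theorem su2_areaLawOnBallW_dim3_oneHalf_w65 {mv : ℕ} (hmv : 1 ≤ mv) :
    AreaLawOnBallW 2 3 (1 / 4) (Real.log (6 / 5)) (9 / 50) (9 / 100) mv := by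
  have h6 : (1 / 4 : ℝ) = 1 / 2 / 2 := by norm_num
  rw [h6]
  show AreaLawOnBallW 2 (2 + 1) _ _ _ _ mv
  refine su2_areaLawOnBallW_dim3_of_row (βW := 1 / 2) (by norm_num) (by norm_num) (Real.log_pos (by norm_num)) (by norm_num)
    hmv ?_
  refine su2_rowW_dim3_lt_one_of_bounds (by norm_num) (by norm_num) exp_log_six_fifths_div_two_le
    (exp_le_taylor4 (x := 9 / 50) (by norm_num) (by norm_num)) sqrt_two_le ?_
  norm_num

/-- **CERTIFIED SU(2), d = 3 TIER-2 AREA-LAW ROW `(β⋆_W, κ, ε) = (3/4, log(6/5), 3/100)`** (tree coupling `3/8`):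
`AreaLawOnBallW 2 3 (3/8) (log(6/5)) (3/50) (3/100) mv` for every `mv ≥ 1`. [folklore] -/
theorem su2_areaLawOnBallW_dim3_threeQuarters_w65 {mv : ℕ} (hmv : 1 ≤ mv) :
    AreaLawOnBallW 2 3 (3 / 8) (Real.log (6 / 5)) (3 / 50) (3 / 100) mv := by
  have h6 : (3 / 8 : ℝ) = 3 / 4 / 2 := by norm_num
  rw [h6]
  show AreaLawOnBallW 2 (2 + 1) _ _ _ _ mv
  refine su2_areaLawOnBallW_dim3_of_row (βW := 3 / 4) (by norm_num) (by norm_num) (Real.log_pos (by norm_num)) (by norm_num)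
    hmv ?_
  refine su2_rowW_dim3_lt_one_of_bounds (by norm_num) (by norm_num) exp_log_six_fifths_div_two_le
    (exp_le_taylor4 (x := 3 / 50) (by norm_num) (by norm_num)) sqrt_two_le ?_
  norm_num

end Summit.Ventures.YMGap.RobustBall
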